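import Literature.Analysis.FluidPDE.NSHopfEnergy
import HarnessLib

/-!
# Hopf's theorem on the torus: weak `L²` convergence of the Galerkin slices at every time

Trunk: FluidKinetic (`Literature/Analysis/FluidPDE`). Complement to the passage to the limit in
the Fourier–Galerkin scheme (`NSHopfLimit`, `NSHopfEnergy`, `NSHopfGalerkinLimit`;
Robinson–Rodrigo–Sadowski 2016, Thm. 4.4, Step 3): the limit field `u` of
`IsHopfGalerkinScheme.exists_limitField` is the coefficientwise limit of the approximations at
every time `t ≥ 0`, with `∑ₖ‖Û_n(t,k)‖²` bounded uniformly in `n` and `t ∈ [0,T]`; hence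
`U n t ⇀ u t` **weakly in `L²(T^d)` for every `t ≥ 0`** — RRS (4.12), "`u_n(t) ⇀ u(t)` in `L²`
for every `t`", the statement quoted in the docstring of `hopf_galerkin_limit` but so far proved in
the tree only in the integrated forms (strong `L²ₜₓ` convergence
`IsHopfGalerkinScheme.tendsto_lintegral_enorm_sub_sq`, convergence of the forcing work
`tendsto_work`) and as the weak continuity of the limit (`continuousOn_integral_inner_limit`).

* `Torus.tendsto_integral_inner_of_tendsto_mFourierCoeff` — the abstract fact: on `T^d`,
  coefficientwise convergence `v̂ₙ(k) → ŵ(k)` under a uniform bound `∫‖v n‖², ∫‖w‖² ≤ Y` gives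
  `∫⟪a, v n⟫ → ∫⟪a, w⟫` for every `a ∈ L²` (Parseval; uniformly small tails by Young's inequality
  with a free parameter, as in `continuousOn_integral_inner_limit`).
* `IsHopfGalerkinScheme.tendsto_integral_inner_limit` — RRS (4.12) for the scheme.

## Mathlib / tree search

Mathlib has weak convergence only abstractly (`WeakSpace`); nothing for `L²` of the torus via
Fourier coefficients. Tree: `Torus.hasSum_re_inner_mFourierCoeff_complexify`,
`Torus.hasSum_sq_norm_mFourierCoeff_complexify` (Parseval, `TorusVectorParseval`),
`Torus.mul_le_young`, `IsHopfGalerkinScheme.integral_norm_sq_le` / `integral_norm_sq_zero_le` /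
`integral_norm_sq_limit_le` / `exists_force_bound` (`NSHopfLimit`). Searched
`tendsto_integral_inner`, `weak` in `Literature/Analysis/FluidPDE` and `FunctionSpaces`: only
`tendsto_integral_inner_of_tendsto_eLpNorm*` (strong convergence) and
`tendsto_integral_inner_fourierTruncate` (truncations of a fixed field).

## References

* J. C. Robinson, J. L. Rodrigo, W. Sadowski, *The three-dimensional Navier–Stokes equations*,
  CUP 2016, Thm. 4.4 Step 3, (4.12), Ex. 4.3. [RobinsonRodrigoSadowski2016]
* E. Hopf, Math. Nachr. 4 (1951), §4.
-/

noncomputable section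

open MeasureTheory Set Filter Topology UnitAddTorus
open scoped ENNReal NNReal InnerProductSpace RealInnerProductSpace

namespace Literature.Analysis.FluidPDE

open FunctionSpaces FunctionSpaces.Torus Torus

section General

variable {d : Type*} [Fintype d]

/-- **Weak `L²` convergence from coefficientwise convergence under a uniform `L²` bound**: if
`v n, w ∈ L²(T^d; ℝ^d)` with `∫‖v n‖² ≤ Y`, `∫‖w‖² ≤ Y` and `v̂ₙ(k) → ŵ(k)` for every `k`, then
`∫⟪a, v n⟫ → ∫⟪a, w⟫` for every `a ∈ L²` (Parseval; the tails are uniformly small by Young's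
inequality with a free parameter — Robinson–Rodrigo–Sadowski 2016, Thm. 4.4 Step 3 and
Ex. 4.3, `U n t ⇀ u t` weakly in `L²`). [cite: RobinsonRodrigoSadowski2016, Thm. 4.4 Step 3] -/
theorem Torus.tendsto_integral_inner_of_tendsto_mFourierCoeff [DecidableEq d]
    {v : ℕ → UnitAddTorus d → EuclideanSpace ℝ d} {w a : UnitAddTorus d → EuclideanSpace ℝ d}
    (hv : ∀ n, MemLp (v n) 2 volume) (hw : MemLp w 2 volume) (ha : MemLp a 2 volume) {Y : ℝ}
    (hYv : ∀ n, ∫ x, ‖v n x‖ ^ 2 ≤ Y) (hYw : ∫ x, ‖w x‖ ^ 2 ≤ Y)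
    (hc : ∀ k, Tendsto (fun n => mFourierCoeff (EuclideanSpace.complexify ∘ v n) k) atTop
      (𝓝 (mFourierCoeff (EuclideanSpace.complexify ∘ w) k))) :
    Tendsto (fun n => ∫ x, ⟪a x, v n x⟫) atTop (𝓝 (∫ x, ⟪a x, w x⟫)) := by
  -- the coefficients of `a`
  obtain ⟨A, hA⟩ : ∃ A : (d → ℤ) → EuclideanSpace ℂ d,
      A = fun k => mFourierCoeff (EuclideanSpace.complexify ∘ a) k := ⟨_, rfl⟩
  obtain ⟨ba, hba⟩ : ∃ ba : (d → ℤ) → ℝ, ba = fun k => ‖A k‖ ^ 2 := ⟨_, rfl⟩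
  have hba_sum : Summable ba := by
    rw [hba, hA]; exact (hasSum_sq_norm_mFourierCoeff_complexify ha).summable
  have hY0 : 0 ≤ Y := le_trans (integral_nonneg fun x => sq_nonneg _) hYw
  -- the partial sums of the Parseval series of `∫⟪a, q⟫`
  obtain ⟨P, hP⟩ : ∃ P : ℕ → (UnitAddTorus d → EuclideanSpace ℝ d) → ℝ,
      P = fun M q => ∑ k ∈ freqBall M,
        (inner ℂ (A k) (mFourierCoeff (EuclideanSpace.complexify ∘ q) k)).re := ⟨_, rfl⟩
  -- uniform tail estimate
  have key : ∀ {q : UnitAddTorus d → EuclideanSpace ℝ d}, MemLp q 2 volume →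
      (∫ x, ‖q x‖ ^ 2) ≤ Y → ∀ {lam : ℝ}, 0 < lam → ∀ M : ℕ,
        |(∫ x, ⟪a x, q x⟫) - P M q| ≤
          lam / 2 * Y + (2 * lam)⁻¹ * ∑' k : {k // k ∉ freqBall (d := d) M}, ba k := by
    intro q hq hqY lam hlam M
    obtain ⟨α, hα⟩ : ∃ α : (d → ℤ) → ℝ,
        α = fun k => (inner ℂ (A k) (mFourierCoeff (EuclideanSpace.complexify ∘ q) k)).re :=
      ⟨_, rfl⟩
    have hsum : HasSum α (∫ x, ⟪a x, q x⟫) := by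
      rw [hα, hA]; exact hasSum_re_inner_mFourierCoeff_complexify ha hq
    have hat : Summable α := hsum.summable
    obtain ⟨bq, hbq⟩ : ∃ bq : (d → ℤ) → ℝ,
        bq = fun k => ‖mFourierCoeff (EuclideanSpace.complexify ∘ q) k‖ ^ 2 := ⟨_, rfl⟩
    have hbq_sum : HasSum bq (∫ x, ‖q x‖ ^ 2) := by
      rw [hbq]; exact hasSum_sq_norm_mFourierCoeff_complexify hq
    have hsplit := hat.sum_add_tsum_compl (s := freqBall M)
    rw [hsum.tsum_eq] at hsplit
    have hPM : P M q = ∑ k ∈ freqBall M, α k := by rw [hP, hα]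
    have hdiff : (∫ x, ⟪a x, q x⟫) - P M q =
        ∑' k : ↥((freqBall M : Finset (d → ℤ)) : Set (d → ℤ))ᶜ, α k := by
      rw [hPM]; linarith
    rw [hdiff]
    obtain ⟨b, hb⟩ : ∃ b : (d → ℤ) → ℝ, b = fun k => lam / 2 * bq k + (2 * lam)⁻¹ * ba k :=
      ⟨_, rfl⟩
    have hb_sum : Summable b := by
      rw [hb]; exact (hbq_sum.summable.mul_left _).add (hba_sum.mul_left _)
    have hpt : ∀ k, ‖α k‖ ≤ b k := by
      intro k
      rw [Real.norm_eq_abs, hα, hb, hbq, hba]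
      refine (Complex.abs_re_le_norm _).trans ((norm_inner_le_norm _ _).trans ?_)
      rw [mul_comm]
      exact Torus.mul_le_young _ _ hlam
    have h1 : ‖∑' k : ↥((freqBall M : Finset (d → ℤ)) : Set (d → ℤ))ᶜ, α k‖ ≤
        ∑' k : ↥((freqBall M : Finset (d → ℤ)) : Set (d → ℤ))ᶜ, b k :=
      HasSum.norm_le_of_bounded (hat.subtype _).hasSum (hb_sum.subtype _).hasSum fun k => hpt k
    rw [Real.norm_eq_abs] at h1
    refine h1.trans ?_
    have h2 : ∑' k : ↥((freqBall M : Finset (d → ℤ)) : Set (d → ℤ))ᶜ, b k =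
        lam / 2 * ∑' k : ↥((freqBall M : Finset (d → ℤ)) : Set (d → ℤ))ᶜ, bq k +
          (2 * lam)⁻¹ * ∑' k : ↥((freqBall M : Finset (d → ℤ)) : Set (d → ℤ))ᶜ, ba k := by
      have hs1 : Summable fun k : ↥((freqBall M : Finset (d → ℤ)) : Set (d → ℤ))ᶜ =>
          lam / 2 * bq k := (hbq_sum.summable.subtype _).mul_left _
      have hs2 : Summable fun k : ↥((freqBall M : Finset (d → ℤ)) : Set (d → ℤ))ᶜ =>
          (2 * lam)⁻¹ * ba k := (hba_sum.subtype _).mul_left _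
      rw [← tsum_mul_left, ← tsum_mul_left, ← hs1.tsum_add hs2, hb]
    rw [h2]
    have h3 : ∑' k : ↥((freqBall M : Finset (d → ℤ)) : Set (d → ℤ))ᶜ, bq k ≤ Y := by
      refine le_trans (Summable.tsum_subtype_le bq _ (fun k => ?_) hbq_sum.summable) ?_
      · rw [hbq]; exact sq_nonneg _
      · rw [hbq_sum.tsum_eq]; exact hqY
    have h4 : ∑' k : ↥((freqBall M : Finset (d → ℤ)) : Set (d → ℤ))ᶜ, ba k =
        ∑' k : {k // k ∉ freqBall (d := d) M}, ba k := rfl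
    rw [h4]
    nlinarith [mul_le_mul_of_nonneg_left h3 (show 0 ≤ lam / 2 by positivity)]
  -- tails of `a`
  have htail : Tendsto (fun M : ℕ => ∑' k : {k // k ∉ freqBall (d := d) M}, ba k) atTop (𝓝 0) :=
    (tendsto_tsum_compl_atTop_zero ba).comp tendsto_freqBall_atTop
  rw [Metric.tendsto_atTop]
  intro ε hε
  obtain ⟨lam, hlamdef⟩ : ∃ lam : ℝ, lam = ε / (4 * (Y + 1)) := ⟨_, rfl⟩
  have hlam0 : 0 < lam := by rw [hlamdef]; positivity
  have h1 : lam / 2 * Y < ε / 8 := by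
    have hY1 : Y / (Y + 1) < 1 := (div_lt_one (by positivity)).2 (lt_add_one Y)
    have : lam / 2 * Y = ε / 8 * (Y / (Y + 1)) := by rw [hlamdef]; field_simp; ring
    rw [this]
    exact mul_lt_of_lt_one_right (by positivity) hY1
  obtain ⟨M, hM⟩ : ∃ M : ℕ, ∑' k : {k // k ∉ freqBall (d := d) M}, ba k < lam * ε / 4 :=
    (htail.eventually (gt_mem_nhds (show (0 : ℝ) < lam * ε / 4 by positivity))).exists
  have h2 : (2 * lam)⁻¹ * ∑' k : {k // k ∉ freqBall (d := d) M}, ba k < ε / 8 := by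
    calc (2 * lam)⁻¹ * ∑' k : {k // k ∉ freqBall (d := d) M}, ba k
        < (2 * lam)⁻¹ * (lam * ε / 4) := mul_lt_mul_of_pos_left hM (by positivity)
      _ = ε / 8 := by field_simp; ring
  -- the finitely many low modes converge
  have hfin : Tendsto (fun n => P M (v n)) atTop (𝓝 (P M w)) := by
    rw [hP]
    exact tendsto_finsetSum _ fun k _ =>
      (Complex.continuous_re.tendsto _).comp (tendsto_const_nhds.inner (hc k))
  obtain ⟨N, hN⟩ := (Metric.tendsto_atTop.1 hfin) (ε / 4) (by positivity)
  refine ⟨N, fun n hn => ?_⟩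
  have e1 := key (hv n) (hYv n) hlam0 M
  have e2 := key hw hYw hlam0 M
  have e3 := hN n hn
  rw [Real.dist_eq] at e3 ⊢
  have e4 : |(∫ x, ⟪a x, v n x⟫) - ∫ x, ⟪a x, w x⟫| ≤
      |(∫ x, ⟪a x, v n x⟫) - P M (v n)| + (|P M (v n) - P M w| + |P M w - ∫ x, ⟪a x, w x⟫|) :=
    (abs_sub_le _ _ _).trans (add_le_add le_rfl (abs_sub_le _ _ _))
  rw [abs_sub_comm (P M w)] at e4
  linarith


end General

/-! ### RRS (4.12): the Galerkin slices converge weakly in `L²` at every time -/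

section Scheme

variable {d : Type*} [Fintype d] [DecidableEq d] {ν : ℝ}
  {f : ℝ → UnitAddTorus d → EuclideanSpace ℝ d} {u₀ : UnitAddTorus d → EuclideanSpace ℝ d}
  {N : ℕ → ℕ} {F U : ℕ → ℝ → UnitAddTorus d → EuclideanSpace ℝ d}
  {u : ℝ → UnitAddTorus d → EuclideanSpace ℝ d}

/-- **Weak `L²` convergence of the Galerkin slices at every time** (Robinson–Rodrigo–Sadowski
2016, Thm. 4.4 Step 3, (4.12): "`u_n(t) ⇀ u(t)` in `L²` for every `t ∈ [0,T]`"; Hopf 1951, §4).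
If the approximations of a Hopf–Galerkin scheme converge coefficientwise at every time `t ≥ 0`
to a field `u` with `L²` slices (the output of `IsHopfGalerkinScheme.exists_limitField` along the
extracted subsequence), then `∫⟪U n t, w⟫ → ∫⟪u t, w⟫` for every `w ∈ L²(T^d)` and every `t ≥ 0`
(`ν ≥ 0`): the uniform bound `∫‖U n t‖² ≤ 2‖u₀‖² + 4TA` (`integral_norm_sq_le`) and its limit
form (`integral_norm_sq_limit_le`) feed `Torus.tendsto_integral_inner_of_tendsto_mFourierCoeff`. [cite: RobinsonRodrigoSadowski2016, Thm. 4.4 Step 3 (4.12)] -/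
theorem IsHopfGalerkinScheme.tendsto_integral_inner_limit (hS : IsHopfGalerkinScheme ν f u₀ N F U)
    (hν : 0 ≤ ν) (hu₀ : MemLp u₀ 2 volume)
    (hfm : AEStronglyMeasurable (stLift f) (volume.restrict (Ioi 0 ×ˢ univ)))
    (hf₂ : ∀ T, 0 < T → ∫⁻ t in Ioo 0 T, ∫⁻ x, ‖f t x‖ₑ ^ 2 < ⊤)
    (hu : ∀ t, 0 ≤ t → MemLp (u t) 2 volume)
    (hc : ∀ t, 0 ≤ t → ∀ k, Tendsto (fun n => mFourierCoeff (EuclideanSpace.complexify ∘ U n t) k)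
      atTop (𝓝 (mFourierCoeff (EuclideanSpace.complexify ∘ u t) k)))
    {w : UnitAddTorus d → EuclideanSpace ℝ d} (hw : MemLp w 2 volume) {t : ℝ} (ht : 0 ≤ t) :
    Tendsto (fun n => ∫ x, ⟪U n t x, w x⟫) atTop (𝓝 (∫ x, ⟪u t x, w x⟫)) := by
  have hT : 0 < t + 1 := by linarith
  obtain ⟨A, hA, hFA⟩ := hS.exists_force_bound hfm hf₂ hT
  obtain ⟨Y, hYdef⟩ : ∃ Y : ℝ, Y = 2 * (∫ x, ‖u₀ x‖ ^ 2) + 4 * (t + 1) * A.toReal := ⟨_, rfl⟩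
  have htI : t ∈ Icc 0 (t + 1) := ⟨ht, by linarith⟩
  have hYn : ∀ n, ∫ x, ‖U n t x‖ ^ 2 ≤ Y := fun n =>
    (hS.integral_norm_sq_le hν hT hA n (hFA n) htI).trans (by
      have := hS.integral_norm_sq_zero_le hu₀ n
      rw [hYdef]; linarith)
  have hYu : ∫ x, ‖u t x‖ ^ 2 ≤ Y := by
    rw [hYdef]; exact hS.integral_norm_sq_limit_le hν hu₀ hu hc hT hA hFA htI
  have h := Torus.tendsto_integral_inner_of_tendsto_mFourierCoeff (a := w)
    (fun n => hS.memLp_slice n ht) (hu t ht) hw hYn hYu (hc t ht)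
  have hcomm : ∀ v : UnitAddTorus d → EuclideanSpace ℝ d,
      (∫ x, ⟪v x, w x⟫) = ∫ x, ⟪w x, v x⟫ := fun v =>
    integral_congr_ae (ae_of_all _ fun x => real_inner_comm _ _)
  simp_rw [hcomm]
  exact h

end Scheme

end Literature.Analysis.FluidPDE

end
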